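import Summits.AtomisticToContinuum.Crystallization.Theses.ReggeStarCoercivity

/-!
# Negative knowledge for crux `DefectFreeCrystallizes` — the 1/20-defect predicate UNBUNDLED,
# with its tightness facts (standing disprover, cycle 2; supports stmt-AtomisticToContinuum-13603)

`nbrs` / `shell` / `Good` / `defects` are VERBATIM the sub-expressions of
`ReggeStarCoercivity.ZeroDefectDensity` (= the hypothesis of `DefectFreeCrystallizes`):
`zeroDefectDensity_iff` and `defectFreeCrystallizes_iff` are `Iff.rfl`. Facts every line needs and
every refutation attempt met: `not_good_of_le_twelve` / `defects_eq_of_le_twelve` (N ≤ 12 ⇒ all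
sites defective: `H` is purely asymptotic), `Good.exists_annulus` (radial pinning to
`[19a/20, 21a/20]`), `Good.card_nbrs_eq` (injective ⇒ exactly 12 neighbours within 6/5),
`good_not_closed` (the predicate is NOT closed under limits of configurations — closed cutoff
`6/5`; hull lines must carry "limit of good"). Per-site corollaries of the sibling files
`Negative.TypeGap` / `Negative.IcosahedralShellsCharged` / `Negative.StrainBlindness` (type well
defined; icosahedral shells defective; uniaxial strains in `[−2/21, 2/19]` invisible) follow by
`shell_eq_image_image` and are kept in the crux workfile `Cruxes/DefectFreeCrystallizes/Disproof.lean`.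
-/

noncomputable section

namespace Summit.AtomisticToContinuum.Crystallization.Theorems.DefectFreeCrystallizes.Negative.PredicateAPI

open Summit.AtomisticToContinuum.Crystallization.Theses.ReggeStarCoercivity
open Literature.MathematicalPhysics.StatisticalMechanics Literature.Geometry.DiscreteGeometry
open Filter Topology

section Predicate

variable {N : ℕ}

/-- Indices of the other particles within distance `6/5` of particle `i` (the crux's filter). -/
def nbrs (x : Fin N → EuclideanSpace ℝ (Fin 3)) (i : Fin N) : Finset (Fin N) :=
  Finset.univ.filter fun j : Fin N => j ≠ i ∧ dist (x i) (x j) ≤ 6 / 5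

/-- The recentred first shell of `i`, rescaled by `a⁻¹` (the crux's image). -/
def shell (x : Fin N → EuclideanSpace ℝ (Fin 3)) (i : Fin N) (a : ℝ) : Finset (EuclideanSpace ℝ (Fin 3)) :=
  (nbrs x i).image fun j => a⁻¹ • (x j - x i)

/-- Site `i` is GOOD (non-defective) in the sense of the crux: some admissible scale `a ∈ [9/10, 11/10]`
makes its rescaled shell `1/20`-close, after a linear isometry, to the fcc or the hcp kissing pattern. -/
def Good (x : Fin N → EuclideanSpace ℝ (Fin 3)) (i : Fin N) : Prop :=
  ∃ a : ℝ, 9 / 10 ≤ a ∧ a ≤ 11 / 10 ∧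
    (ShellCloseTo (1 / 20) (shell x i a) fccKissingPattern ∨
      ShellCloseTo (1 / 20) (shell x i a) hcpKissingPattern)

/-- Number of defective sites. -/
def defects (x : Fin N → EuclideanSpace ℝ (Fin 3)) : ℕ := Nat.card {i : Fin N // ¬ Good x i}

/-- `ZeroDefectDensity` restated through `defects` (definitional). [folklore] -/
theorem zeroDefectDensity_iff :
    ZeroDefectDensity ↔ ∀ x : (N : ℕ) → (Fin N → EuclideanSpace ℝ (Fin 3)), (∀ N, IsGroundState lennardJones (x N)) →
      Tendsto (fun N : ℕ => (defects (x N) : ℝ) / N) atTop (𝓝 0) :=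
  Iff.rfl

/-- The crux restated through `defects` (definitional). [folklore] -/
theorem defectFreeCrystallizes_iff :
    DefectFreeCrystallizes ↔
      ((∀ x : (N : ℕ) → (Fin N → EuclideanSpace ℝ (Fin 3)), (∀ N, IsGroundState lennardJones (x N)) →
        Tendsto (fun N : ℕ => (defects (x N) : ℝ) / N) atTop (𝓝 0)) →
      IsCrystallizing lennardJones 3) :=
  Iff.rfl

/-- A site has at most `N - 1` neighbours. [folklore] -/
theorem card_nbrs_le (x : Fin N → EuclideanSpace ℝ (Fin 3)) (i : Fin N) : (nbrs x i).card ≤ N - 1 := by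
  have h : nbrs x i ⊆ Finset.univ.erase i := by
    intro j hj
    simp only [nbrs, Finset.mem_filter, Finset.mem_univ, true_and] at hj
    exact Finset.mem_erase.2 ⟨hj.1, Finset.mem_univ j⟩
  calc (nbrs x i).card ≤ (Finset.univ.erase i).card := Finset.card_le_card h
    _ = N - 1 := by rw [Finset.card_erase_of_mem (Finset.mem_univ i), Finset.card_univ, Fintype.card_fin]

/-- The rescaled shell has at most as many points as there are neighbours. [folklore] -/
theorem card_shell_le (x : Fin N → EuclideanSpace ℝ (Fin 3)) (i : Fin N) (a : ℝ) : (shell x i a).card ≤ (nbrs x i).card :=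
  Finset.card_image_le

/-- For an injective configuration and `a ≠ 0` the shell has exactly as many points as there are
neighbours. [folklore] -/
theorem card_shell_eq {x : Fin N → EuclideanSpace ℝ (Fin 3)} (hx : Function.Injective x) (i : Fin N) {a : ℝ} (ha : a ≠ 0) :
    (shell x i a).card = (nbrs x i).card := by
  apply Finset.card_image_of_injective
  intro j k hjk
  have : x j - x i = x k - x i := smul_right_injective (EuclideanSpace ℝ (Fin 3)) (inv_ne_zero ha) hjk
  exact hx (sub_left_injective this)

/-- A good site has a twelve-point rescaled shell at its admissible scale. [folklore] -/
theorem Good.exists_card_eq {x : Fin N → EuclideanSpace ℝ (Fin 3)} {i : Fin N} (h : Good x i) :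
    ∃ a : ℝ, 9 / 10 ≤ a ∧ a ≤ 11 / 10 ∧ (shell x i a).card = 12 ∧
      (ShellCloseTo (1 / 20) (shell x i a) fccKissingPattern ∨
        ShellCloseTo (1 / 20) (shell x i a) hcpKissingPattern) := by
  obtain ⟨a, ha₁, ha₂, h⟩ := h
  exact ⟨a, ha₁, ha₂, card_eq_twelve_of_shellCloseTo h, h⟩

/-- A good site has at least twelve neighbours within `6/5`. [folklore] -/
theorem Good.twelve_le_card_nbrs {x : Fin N → EuclideanSpace ℝ (Fin 3)} {i : Fin N} (h : Good x i) :
    12 ≤ (nbrs x i).card := by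
  obtain ⟨a, -, -, hc, -⟩ := h.exists_card_eq
  exact hc ▸ card_shell_le x i a

/-- A good site of an INJECTIVE configuration has exactly twelve neighbours within `6/5`. [folklore] -/
theorem Good.card_nbrs_eq {x : Fin N → EuclideanSpace ℝ (Fin 3)} (hx : Function.Injective x) {i : Fin N} (h : Good x i) :
    (nbrs x i).card = 12 := by
  obtain ⟨a, ha₁, -, hc, -⟩ := h.exists_card_eq
  rwa [card_shell_eq hx i (by linarith : a ≠ 0)] at hc

/-- **Small systems are all-defective**: with `N ≤ 12` particles no site is good (a shell has at
most `N - 1 ≤ 11 < 12` points). So the defect RATIO is `1` for `1 ≤ N ≤ 12`: the hypothesis `H` is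
purely asymptotic. [folklore] -/
theorem not_good_of_le_twelve (hN : N ≤ 12) (x : Fin N → EuclideanSpace ℝ (Fin 3)) (i : Fin N) : ¬ Good x i := by
  intro h
  have h12 := h.twelve_le_card_nbrs
  have := card_nbrs_le x i
  omega

/-- Hence `defects x = N` whenever `N ≤ 12`. [folklore] -/
theorem defects_eq_of_le_twelve (hN : N ≤ 12) (x : Fin N → EuclideanSpace ℝ (Fin 3)) : defects x = N := by
  unfold defects
  rw [Nat.card_congr (Equiv.subtypeUnivEquiv (not_good_of_le_twelve hN x)), Nat.card_eq_fintype_card,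
    Fintype.card_fin]

/-- **Radial pinning of a good shell**: if the rescaled shell is `η`-close to a pattern of UNIT
vectors, every neighbour within `6/5` sits at distance within `a·η` of `a` (for `a > 0`). [folklore] -/
theorem dist_sub_le_of_shellCloseTo {x : Fin N → EuclideanSpace ℝ (Fin 3)} {i : Fin N} {a η : ℝ} (ha : 0 < a)
    {P : Finset (EuclideanSpace ℝ (Fin 3))} (hP : ∀ p ∈ P, ‖p‖ = 1) (h : ShellCloseTo η (shell x i a) P)
    {j : Fin N} (hj : j ∈ nbrs x i) : |dist (x j) (x i) - a| ≤ a * η := by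
  obtain ⟨A, e, he⟩ := h
  have ht : a⁻¹ • (x j - x i) ∈ shell x i a := Finset.mem_image_of_mem _ hj
  set q : EuclideanSpace ℝ (Fin 3) := (e ⟨_, ht⟩ : EuclideanSpace ℝ (Fin 3)) with hq
  have hqmem : q ∈ P.image A := (e ⟨_, ht⟩).2
  obtain ⟨p, hp, hpq⟩ := Finset.mem_image.1 hqmem
  have hqn : ‖q‖ = 1 := by rw [← hpq, A.norm_map, hP p hp]
  have h1 : |‖a⁻¹ • (x j - x i)‖ - ‖q‖| ≤ η :=
    (abs_norm_sub_norm_le _ _).trans (by simpa [dist_eq_norm, hq] using he ⟨_, ht⟩)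
  rw [hqn, norm_smul, norm_inv, Real.norm_of_nonneg ha.le] at h1
  rw [dist_eq_norm]
  have hmul := mul_le_mul_of_nonneg_left h1 ha.le
  rw [← abs_of_pos ha, ← abs_mul, abs_of_pos ha] at hmul
  have : a * (a⁻¹ * ‖x j - x i‖ - 1) = ‖x j - x i‖ - a := by field_simp
  rwa [this] at hmul

/-- For a good site: all neighbours within `6/5` lie in the annulus `[19a/20, 21a/20]` about it, for
its admissible scale `a`; in particular in `[0.855, 1.155]`. [folklore] -/
theorem Good.exists_annulus {x : Fin N → EuclideanSpace ℝ (Fin 3)} {i : Fin N} (h : Good x i) :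
    ∃ a : ℝ, 9 / 10 ≤ a ∧ a ≤ 11 / 10 ∧
      ∀ j ∈ nbrs x i, 19 / 20 * a ≤ dist (x j) (x i) ∧ dist (x j) (x i) ≤ 21 / 20 * a := by
  obtain ⟨a, ha₁, ha₂, h⟩ := h
  refine ⟨a, ha₁, ha₂, fun j hj => ?_⟩
  have ha : 0 < a := by linarith
  have key : |dist (x j) (x i) - a| ≤ a * (1 / 20) := by
    rcases h with h | h
    · exact dist_sub_le_of_shellCloseTo ha (fun p hp => norm_eq_one_of_mem_fccKissingPattern hp) h hj
    · exact dist_sub_le_of_shellCloseTo ha (fun p hp => norm_eq_one_of_mem_hcpKissingPattern hp) h hj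
  rw [abs_le] at key
  constructor <;> linarith [key.1, key.2]

/-- What `H` does NOT constrain (recorded for provers): membership in `nbrs` is the CLOSED condition
`dist ≤ 6/5` and matching is the CLOSED condition `≤ 1/20`, but `Good` is NOT closed under limits of
configurations — see `good_not_closed` below: a thirteenth particle approaching distance `6/5` from
outside keeps the site good and makes the limit defective. [folklore] -/
theorem mem_nbrs_iff {x : Fin N → EuclideanSpace ℝ (Fin 3)} {i j : Fin N} :
    j ∈ nbrs x i ↔ j ≠ i ∧ dist (x i) (x j) ≤ 6 / 5 := by
  simp [nbrs]

/-- The crux's shell, as a rescaling of the raw displacement set. [folklore] -/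
theorem shell_eq_image_image (x : Fin N → EuclideanSpace ℝ (Fin 3)) (i : Fin N) (a : ℝ) :
    shell x i a = ((nbrs x i).image fun j => x j - x i).image fun v => a⁻¹ • v := by
  rw [Finset.image_image]; rfl


end Predicate

section Trap

/-- The twelve fcc integer vectors, enumerated (same order as `fccInt`). -/
def fccList : Fin 12 → (Fin 3 → ℤ) :=
  ![![1, 1, 0], ![1, -1, 0], ![-1, 1, 0], ![-1, -1, 0], ![1, 0, 1], ![1, 0, -1], ![-1, 0, 1],
    ![-1, 0, -1], ![0, 1, 1], ![0, 1, -1], ![0, -1, 1], ![0, -1, -1]]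

/-- The integer fcc model, enumerated. [folklore] -/
theorem fccInt_eq_image : fccInt = Finset.univ.image fccList := by decide

/-- The twelve fcc kissing points, enumerated. -/
def fccPt (k : Fin 12) : EuclideanSpace ℝ (Fin 3) := (Real.sqrt (2 : ℕ))⁻¹ • intVec (fccList k)

/-- The fcc kissing pattern, enumerated. [folklore] -/
theorem fccKissingPattern_eq_image : fccKissingPattern = Finset.univ.image fccPt := by
  rw [fccKissingPattern, scaledPattern, fccInt_eq_image, Finset.image_image]
  rfl

/-- Enumerated points belong to the pattern. [folklore] -/
theorem fccPt_mem (k : Fin 12) : fccPt k ∈ fccKissingPattern := by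
  rw [fccKissingPattern_eq_image]; exact Finset.mem_image_of_mem _ (Finset.mem_univ k)

/-- Enumerated points are unit vectors. [folklore] -/
theorem norm_fccPt (k : Fin 12) : ‖fccPt k‖ = 1 :=
  norm_eq_one_of_mem_fccKissingPattern (fccPt_mem k)

/-- The trap family: particle `0` at the origin, particles `1..12` on the unit fcc shell, particle
`13` at distance `6/5 + t` on the ray through `fccPt 0`. -/
def trapConfig (t : ℝ) : Fin 14 → EuclideanSpace ℝ (Fin 3) := fun j =>
  if h0 : j.1 = 0 then 0 else if h13 : j.1 = 13 then ((6 : ℝ) / 5 + t) • fccPt 0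
    else fccPt ⟨j.1 - 1, by omega⟩

/-- Particle `0` of the trap family sits at the origin. [folklore] -/
@[simp] theorem trapConfig_zero (t : ℝ) : trapConfig t 0 = 0 := by simp [trapConfig]

/-- Particle `13` of the trap family sits at distance `6/5 + t` on a ray. [folklore] -/
theorem trapConfig_thirteen (t : ℝ) : trapConfig t 13 = ((6 : ℝ) / 5 + t) • fccPt 0 := by
  simp [trapConfig]

/-- Particles `1..12` of the trap family are the fcc shell. [folklore] -/
theorem trapConfig_of_ne (t : ℝ) {j : Fin 14} (h0 : j.1 ≠ 0) (h13 : j.1 ≠ 13) :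
    trapConfig t j = fccPt ⟨j.1 - 1, by omega⟩ := by
  simp [trapConfig, h0, h13]

/-- The trap family is continuous in `t`. [folklore] -/
theorem continuous_trapConfig : Continuous trapConfig := by
  refine continuous_pi fun j => ?_
  by_cases h0 : j.1 = 0
  · simp only [trapConfig, h0]; exact continuous_const
  by_cases h13 : j.1 = 13
  · simp only [trapConfig, h13, dite_true]
    exact (continuous_const.add continuous_id).smul continuous_const
  · simp only [trapConfig, h0, h13, dite_false]; exact continuous_const

/-- Distance from particle `0` to particle `13`. [folklore] -/
theorem dist_trapConfig_thirteen (t : ℝ) (ht : 0 ≤ t) :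
    dist (trapConfig t 0) (trapConfig t 13) = 6 / 5 + t := by
  rw [trapConfig_zero, trapConfig_thirteen, dist_eq_norm, zero_sub, norm_neg, norm_smul, norm_fccPt,
    mul_one, Real.norm_of_nonneg (by positivity)]

/-- Distance from particle `0` to the shell particles. [folklore] -/
theorem dist_trapConfig_of_ne (t : ℝ) {j : Fin 14} (h0 : j.1 ≠ 0) (h13 : j.1 ≠ 13) :
    dist (trapConfig t 0) (trapConfig t j) = 1 := by
  rw [trapConfig_zero, trapConfig_of_ne t h0 h13, dist_eq_norm, zero_sub, norm_neg, norm_fccPt]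

/-- For `t > 0` the `6/5`-neighbourhood of particle `0` is exactly the fcc shell `1..12`. -/
theorem nbrs_trapConfig (t : ℝ) (ht : 0 < t) :
    nbrs (trapConfig t) 0 = Finset.univ.filter fun j : Fin 14 => j.1 ≠ 0 ∧ j.1 ≠ 13 := by
  ext j
  simp only [mem_nbrs_iff, Finset.mem_filter, Finset.mem_univ, true_and]
  by_cases h0 : j.1 = 0
  · have : j = 0 := Fin.ext h0
    simp [this]
  by_cases h13 : j.1 = 13
  · have : j = 13 := Fin.ext h13
    subst this
    rw [dist_trapConfig_thirteen t ht.le]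
    constructor
    · intro h; linarith [h.2]
    · intro h; exact absurd rfl h.2
  · rw [dist_trapConfig_of_ne t h0 h13]
    have hj : j ≠ 0 := fun h => h0 (by rw [h]; rfl)
    simp only [ne_eq, hj, not_false_eq_true, true_and, h0, h13, and_self, iff_true]
    norm_num

/-- For `t > 0` the shell of particle `0` at scale `1` IS the fcc kissing pattern. -/
theorem shell_trapConfig (t : ℝ) (ht : 0 < t) : shell (trapConfig t) 0 1 = fccKissingPattern := by
  rw [shell, nbrs_trapConfig t ht, fccKissingPattern_eq_image]
  ext q
  simp only [Finset.mem_image, Finset.mem_filter, Finset.mem_univ, true_and, inv_one, one_smul,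
    trapConfig_zero, sub_zero]
  constructor
  · rintro ⟨j, ⟨h0, h13⟩, rfl⟩
    exact ⟨⟨j.1 - 1, by omega⟩, (trapConfig_of_ne t h0 h13).symm⟩
  · rintro ⟨k, rfl⟩
    refine ⟨⟨k.1 + 1, by omega⟩, ⟨by simp, by simp; omega⟩, ?_⟩
    rw [trapConfig_of_ne t (by simp) (by simp; omega)]
    congr 1

/-- Along the family, particle `0` is GOOD for every `t > 0` (scale `1`, identity isometry). -/
theorem good_trapConfig (t : ℝ) (ht : 0 < t) : Good (trapConfig t) 0 :=
  ⟨1, by norm_num, by norm_num, Or.inl (by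
    rw [shell_trapConfig t ht]; exact ShellCloseTo.refl (by norm_num) _)⟩

/-- … but in the LIMIT `t = 0` particle `0` is DEFECTIVE: particle `13` is a thirteenth neighbour at
distance exactly `6/5`, which radial pinning would put in `[19a/20, 21a/20]`, forcing `a ≥ 8/7`. -/
theorem not_good_trapConfig_zero : ¬ Good (trapConfig 0) 0 := by
  intro h
  obtain ⟨a, -, ha₂, hann⟩ := h.exists_annulus
  have hmem : (13 : Fin 14) ∈ nbrs (trapConfig 0) 0 := by
    rw [mem_nbrs_iff, dist_trapConfig_thirteen 0 le_rfl]
    exact ⟨by decide, by norm_num⟩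
  have := (hann 13 hmem).2
  rw [dist_comm, dist_trapConfig_thirteen 0 le_rfl] at this
  linarith

/-- **`Good` is not closed.** A continuous one-parameter family of 14-particle configurations whose
particle `0` is good for all `t > 0` and defective at `t = 0`. Consequence for hull lines: local
limits of everywhere-good windows need not be everywhere-good for the crux's predicate verbatim
(closed cutoff `6/5`); carry "limit of good shells" or the open-cutoff variant instead. [folklore] -/
theorem good_not_closed :
    ∃ x : ℝ → (Fin 14 → EuclideanSpace ℝ (Fin 3)), Continuous x ∧ (∀ t, 0 < t → Good (x t) 0) ∧ ¬ Good (x 0) 0 :=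
  ⟨trapConfig, continuous_trapConfig, good_trapConfig, not_good_trapConfig_zero⟩

end Trap



end Summit.AtomisticToContinuum.Crystallization.Theorems.DefectFreeCrystallizes.Negative.PredicateAPI

end
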